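import Mathlib
import HarnessLib
import Summits.CriticalPhenomena.SAWScalingLimit.Theses.SAWRenewalTightness
import Literature.Probability.RandomPlanarGeometry.SAWWordBridges
import Literature.Probability.RandomPlanarGeometry.CrossingCondition

/-!
# Sketch — crux-ideate stmt-CriticalPhenomena-4728 (ShellCrossingBound), ideator 1, round 1

First lemmas of the two idea cards, typed over existing declarations (no proofs):

* card `markov-fibration-pocket`: `PerShellDecay` (rate-free per-shell decay in the number of
  traversals — the soft equivalent of the crux), `NonDegeneracyEta` (KS time-zero G1 for the
  admissible SAW family with ANY constant `η < 1`), `HairpinHysteresis` (the atom of the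
  multi-strand pocket lemma: a hairpin through a half-strip pocket that reached depth `W` reaches
  depth `2W` with conditional mass ratio `≤ η < 1`, uniformly in the width).
* card `kesten-defect-renewal`: `IrrBridgeMomentTail` — the moment–tail inequality for Kesten's
  irreducible-bridge measure that gives `ξ_W(x_c) = O(W)` (linear correlation length of the
  critical-fugacity SAW in a width-`W` strip) by defective renewal theory.
-/

namespace Summit.CriticalPhenomena.SAWScalingLimit.Cruxes.ShellCrossingBound.Sketch

open scoped BigOperators Classical
open MeasureTheory Filter Set
open Literature.Probability.RandomPlanarGeometry Literature.Probability.LatticeModels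

/-- **Rate-free per-shell decay.** For every Dobrushin domain, endpoint approximation and every
FIXED shell `D(x; ρ, R)`, the probability of `k` separate traversals tends to `0` as `k → ∞`,
uniformly in the mesh `δ ≤ δ₀`. Soft claim of card A: `PerShellDecay ↔ ShellCrossingBound`,
both directions through `EventualTight` (⇒: AB (2.22) `Curve.tortuosity_le_of_cover` per scale +
AB Lemma 4.1 `CurveClass.isCompact_closure_image_mk_of_tortuosity_le`, both PROVED in tree, then
tightness ⇒ SCB by the compact-set traversal bound of the route-review remark on stmt-4728;
⇐: SCB ⇒ EventualTight by `isTightMeasureSet_of_traversalBounds` (item TightOfShellCrossing),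
then tightness ⇒ per-shell decay by the same compactness bound). -/
def PerShellDecay : Prop :=
  ∀ (D : DobrushinDomain) (a b : ℝ → Site 2), SAW.IsEndpointApprox D a b →
    ∃ δ₀ : ℝ, 0 < δ₀ ∧ ∀ (x : ℂ) (ρ R : ℝ), 0 < ρ → ρ < R →
      ∀ ε : ℝ, 0 < ε → ∃ k : ℕ, ∀ δ ∈ Set.Ioc (0 : ℝ) δ₀,
        SAW.law D.carrier δ (a δ) (b δ)
          {γ | (⟨γ.walk.toCurve (meshPoint δ)⟩ : Curve ℂ).HasTraversals k x ρ R}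
            ≤ ENNReal.ofReal ε

/-- The admissible SAW family of the sibling item `KSAdmissibleG1` (stmt-CriticalPhenomena-11346),
copied verbatim: simply connected polyominoes `S`, boundary vertices `a b`, plain square cells. -/
def admissibleFamily : Set MarkedLaw :=
  {L : MarkedLaw | ∃ (S : Finset (Site 2)) (δ : ℝ) (a b : Site 2),
    let U : Set ℂ := interior (⋃ v ∈ S, {z : ℂ | |z.re - (meshPoint δ v).re| ≤ δ / 2 ∧
      |z.im - (meshPoint δ v).im| ≤ δ / 2});
    0 < δ ∧ ((zdGraph 2).induce (↑S : Set (Site 2))).Preconnected ∧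
    ((zdGraph 2).induce ((↑S : Set (Site 2))ᶜ)).Preconnected ∧ a ∈ S ∧ b ∈ S ∧
    (∃ w ∉ S, (zdGraph 2).Adj a w) ∧ (∃ w ∉ S, (zdGraph 2).Adj b w) ∧
    L = ⟨U, meshPoint δ a, meshPoint δ b, (SAW.law U δ a b).map (fun γ => γ.curve)⟩}

/-- **Non-degeneracy with an arbitrary constant.** KS time-zero Condition G1 for the admissible
SAW family with `1/2` replaced by any `η < 1` (KS Cor. 2.6: equivalent, given the SAW's exact
domain Markov property `S ↦ S ∖ past`). Card A's transfer `C⁺`. -/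
def NonDegeneracyEta : Prop :=
  ∃ C η : ℝ, 1 < C ∧ η < 1 ∧ ∀ L ∈ admissibleFamily, ∀ (z₀ : ℂ) (r R : ℝ), 0 < r → C * r ≤ R →
    L.law (CurveClass.crossingIn z₀ r R (unforcedPartZero L.U L.a L.b z₀ r R)) ≤ ENNReal.ofReal η

/-- Card A chain, step 1 (soft + KS Lemma 3.6 + exact domain Markov): one non-degeneracy
constant at one aspect ratio gives rate-free per-shell decay `(η)^{(k - k₀(shell))/2}`. -/
def ChainA₁ : Prop := NonDegeneracyEta → PerShellDecay

/-- Card A chain, step 2 (soft, AB99 (2.22) + Lemma 4.1 in tree): per-shell decay is the crux. -/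
def ChainA₂ : Prop :=
  PerShellDecay → Summit.CriticalPhenomena.SAWScalingLimit.Theses.SAWRenewalTightness.ShellCrossingBound

/-- **Hairpin hysteresis (atom of the multi-strand pocket lemma).** In the half-strip pocket
`P_W = {v : 0 ≤ v₀, 0 ≤ v₁ < W}` (depth coordinate `v₀`, mouth line `v₀ = 0`), for mouth points
`p = (0, y₁)`, `q = (0, y₂)`: the `x_c`-mass of SAWs `p → q` inside `P_W` reaching depth `≥ 2W`
is at most `η < 1` times the mass of those reaching depth `≥ W` — uniformly in `W, y₁, y₂`
(partial-sum form: every partial sum of the deep mass is `≤ η ×` some partial sum of the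
`≥ W` mass). Equivalent to a linear bound `ξ_W(x_c) ≤ c W` on the strip correlation length. -/
def HairpinHysteresis : Prop :=
  ∃ η : ℝ, η < 1 ∧ ∀ (W : ℕ), 1 ≤ W → ∀ (y₁ y₂ : ℕ), y₁ < W → y₂ < W → y₁ ≠ y₂ →
    ∀ N : ℕ, ∃ N' : ℕ,
      (∑ n ∈ Finset.range (N + 1),
        ∑ _ω ∈ (SAW.Zd.sawFun 2 n (![0, (y₂ : ℤ)] - ![0, (y₁ : ℤ)])).filter (fun ω =>
            (∀ i ≤ n, 0 ≤ (![0, (y₁ : ℤ)] + ω i) 0 ∧ 0 ≤ (![0, (y₁ : ℤ)] + ω i) 1 ∧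
              (![0, (y₁ : ℤ)] + ω i) 1 < W) ∧
            (∃ i ≤ n, (2 * W : ℤ) ≤ (![0, (y₁ : ℤ)] + ω i) 0)),
          SAW.criticalFugacity ^ n)
      ≤ η * ∑ n ∈ Finset.range (N' + 1),
        ∑ _ω ∈ (SAW.Zd.sawFun 2 n (![0, (y₂ : ℤ)] - ![0, (y₁ : ℤ)])).filter (fun ω =>
            (∀ i ≤ n, 0 ≤ (![0, (y₁ : ℤ)] + ω i) 0 ∧ 0 ≤ (![0, (y₁ : ℤ)] + ω i) 1 ∧
              (![0, (y₁ : ℤ)] + ω i) 1 < W) ∧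
            (∃ i ≤ n, (W : ℤ) ≤ (![0, (y₁ : ℤ)] + ω i) 0)),
          SAW.criticalFugacity ^ n

/-- Vertical extent of a step word: `max_i y(i) - min_i y(i)`. -/
noncomputable def vExt (w : List SAW.Step) : ℤ :=
  (Finset.range (w.length + 1)).sup' ⟨0, by simp⟩ (fun i => SAW.traj w i 1) -
    (Finset.range (w.length + 1)).inf' ⟨0, by simp⟩ (fun i => SAW.traj w i 1)

/-- **Moment–tail inequality for Kesten's irreducible-bridge measure** (card B). Under the
weights `x_c^{|β|}` on irreducible bridges (total mass `1` by Kesten's identity, support item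
`KestenIdentity`), the span of the bridges of vertical extent `< W`, integrated, is at most
`C · W ×` the mass of those of vertical extent `≥ W`: `E[span; vExt < W] ≤ C W P[vExt ≥ W]`.
By defective renewal theory in the width-`W` strip (defect `θ_W = P[does not fit]`, mean inter-
arrival `m_W = E[span; fits]`) this gives `ξ_W(x_c) ≲ m_W/θ_W ≤ C W`, i.e. `HairpinHysteresis`
for straight pockets. Finite-partial-sum form on both sides (junk-free). -/
def IrrBridgeMomentTail : Prop :=
  ∃ C : ℝ, ∀ (W : ℕ), 1 ≤ W → ∀ s : Finset {w : List SAW.Step // SAW.IsIrrBridge w},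
    ∃ t : Finset {w : List SAW.Step // SAW.IsIrrBridge w},
      (∑ w ∈ s with vExt w.1 < W, SAW.criticalFugacity ^ w.1.length * (SAW.xEnd w.1 : ℝ))
        ≤ C * W * ∑ w ∈ t with (W : ℤ) ≤ vExt w.1, SAW.criticalFugacity ^ w.1.length

/-- A step word, translated to start height `y`, stays in the strip `0 ≤ · < W`. -/
def FitsFrom (y : ℤ) (W : ℕ) (w : List SAW.Step) : Prop :=
  ∀ i ≤ w.length, 0 ≤ y + SAW.traj w i 1 ∧ y + SAW.traj w i 1 < W

/-- **Tilted Kraft inequality for Kesten's irreducible bridges in a strip** (card B, the sharp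
sufficient form of `IrrBridgeMomentTail`): for some `c > 0`, every finite set of irreducible
bridges that fit in the width-`W` strip from start height `y` has tilted critical mass
`Σ x_c^{|β|} e^{c·span(β)/W} ≤ 1`. Untilted and unconfined the full sum is exactly `1` (Kesten);
the exponential tilt in `span/W` is to be paid by the confinement defect
`θ_W(y) = P_irr[does not fit]`. Linearising `e^{cs/W} - 1 ≈ cs/W` gives `IrrBridgeMomentTail`. -/
def IrrBridgeTiltedKraft : Prop :=
  ∃ c : ℝ, 0 < c ∧ ∀ (W : ℕ), 1 ≤ W → ∀ (y : ℤ), 0 ≤ y → y < W →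
    ∀ s : Finset {w : List SAW.Step // SAW.IsIrrBridge w},
      (∑ w ∈ s with FitsFrom y W w.1,
        SAW.criticalFugacity ^ w.1.length * Real.exp (c * (SAW.xEnd w.1 : ℝ) / W)) ≤ 1

/-- **Tube-mass hyperscaling** `M_W(x_c) ≥ c/W` with amplitude `1`: the `x_c`-mass of bridges of
span `L` inside the width-`W` strip, from height `y` to height `y'`, is `≤ e^{-cL/W}` (all partial
sums). Madras–Slade Def. 4.1.10 / Lemma 4.1.11 define the truncated masses `M_T(z)` and prove
`M_T(z_c) ↓ M(z_c) = 0` without a rate; the claim is the rate `T · M_T(z_c) ≥ c`, and the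
amplitude `1` comes from super-multiplicativity + reflection symmetry (Fekete on the diagonal,
`u_L(y,y')² ≤ u_{2L}(y,y)`). -/
def TubeMassHyperscaling : Prop :=
  ∃ c : ℝ, 0 < c ∧ ∀ (W : ℕ), 1 ≤ W → ∀ (y y' : ℤ), 0 ≤ y → y < W → 0 ≤ y' → y' < W →
    ∀ (L : ℕ), 1 ≤ L → ∀ N : ℕ,
      (∑ n ∈ Finset.range (N + 1),
        ∑ _ω ∈ (SAW.Zd.bridges 2 n).filter (fun ω =>
            ω n 0 = (L : ℤ) ∧ y + ω n 1 = y' ∧ ∀ i ≤ n, 0 ≤ y + ω i 1 ∧ y + ω i 1 < W),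
          SAW.criticalFugacity ^ n) ≤ Real.exp (-(c * L / W))

/-- Card B chain, step 1: tilted Kraft ⇒ hyperscaling (Markov renewal in the strip: row sums of
the tilted irreducible kernel `≤ 1` bound its Perron root; Fekete + symmetry give amplitude 1). -/
def ChainB₁ : Prop := IrrBridgeTiltedKraft → TubeMassHyperscaling

/-- Card B chain, step 2: hyperscaling ⇒ the depth half of card A's atom (the deep part of a
hairpin beyond its hysteresis line contains a strip bridge of span `(C₀-1)W`); the lateral
closing comparison at the base scale is card A's MSPL business and is flagged, not hidden. -/
def ChainB₂ : Prop := TubeMassHyperscaling → HairpinHysteresis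

/-- The linear shadow used for numerics. -/
def ChainB₀ : Prop := IrrBridgeTiltedKraft → IrrBridgeMomentTail

end Summit.CriticalPhenomena.SAWScalingLimit.Cruxes.ShellCrossingBound.Sketch
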